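import Summits.Ventures.PercRepro.GenQOpenLayersCore
import Summits.Ventures.PercRepro.RLSCoreFlatsSmall

/-!
# PercRepro — the open layers on Core matroids are FINITE statements: `|G| + 1 ≤ 2^q` (night-4, gen 2)

night-3's `card_add_one_le_two_pow_of_core` (`RLSCoreFlatsSmall.lean`) bounds every rank-`q` flat of a Core matroid by
`2^q − 1` points.  So the Core-typed open layers (`OpenLayersCore q`, `GenQOpenLayersCore.lean`) may assume the bound:
`OpenLayersCoreSmall q` is `OpenLayersCore q` with `G.card + 1 ≤ 2 ^ q` as one more hypothesis — at each level a statement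
about finitely many flat sizes — and `openLayersCore_of_small` recovers `OpenLayersCore q`.  At `(7, 5)`: rank-`5` flats have
at most `31` points (`SevenFiveLayersCoreSmall`, `rls_seven_five_of_layersCoreSmall`).

Scope.  `OpenLayers q` (simple matroids) is FALSE for `q ≥ 10` — the witnesses of record are stars of lines through a
centre with `4`-point lines.  On a Core matroid every line has at most `3` points (`card_le_three_of_line_of_core`, the
bound at `q = 2`), so no such star is a flat of a Core matroid.  The shapes the core allows do refute
`OpenLayersCore q` from `q = 12`: the mixed stars «`9` three-point lines + a `K₄` on a common edge» (`t = 7`, balance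
`-7017262/2145`) and «`8` lines + a `K₅`» (`t = 8`, `-56686886/2145`), and the pure star `L3^(q-1)` from `q = 13`
(`t = 7`: `-135120/7`) — each `G ⊕ U_{2,3}` is a Core matroid with `G` a rank-`q` flat (two seats, exact).  So the
Core-typed residue is open for `5 ≤ q ≤ 11` at most, against `5 ≤ q ≤ 9` for the simple-matroid one.

The family `𝔉` is automatic on the core: by night-3's `exists_cover_erase_of_core`, every point `e` of a rank-`q` flat
`G` has `G ∖ e` inside two flats of rank `< q`, so `G ⊆ Z ∪ Z' ∪ {e}` — `TwoHyp M G q` (`twoHyp_of_core`).  Hence the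
Core-typed layers are the balances on ALL rank-`q` flats of Core matroids (`openLayersCore_iff_all`).
-/

namespace PercRepro.GenQ

open Finset ThmH PerFlat SixFour ThmN NightThree

/-- **The open layers of level `q` on Core matroids, on flats of at most `2^q − 1` points** (the three clauses of
`OpenLayers q`). -/
def OpenLayersCoreSmall (q : ℕ) : Prop :=
  ∀ {β : Type} [DecidableEq β] (M : Matroid β) [M.Finite] (G : Finset β), Core M (q + 2) → G ∈ flatsQ M q →
    G.card + 1 ≤ 2 ^ q → TwoHyp M G q →
      (6 ≤ q → q + 2 ≤ G.card → (G.card - q) * (q + 3) + 1 < q * q → 0 ≤ Jq M G q 1) ∧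
      ((G.card - q) * (G.card - q + 3) < 12 * (q - 1) → 0 ≤ Jq M G q 2) ∧
      (∀ t, 3 ≤ t → t + 1 ≤ q → 0 ≤ Jq M G q t)

/-- The size bound is automatic on Core matroids (`card_add_one_le_two_pow_of_core`). -/
theorem openLayersCore_of_small {q : ℕ} (h : OpenLayersCoreSmall q) : OpenLayersCore q := by
  intro β _ M _ G hc hG hF
  exact h M G hc hG (card_add_one_le_two_pow_of_core hc q G hG) hF

/-- **The `(7, 5)` layers on Core matroids of rank `7`, on rank-`5` flats of at most `31` points.** -/
def SevenFiveLayersCoreSmall : Prop :=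
  ∀ {β : Type} [DecidableEq β] (M : Matroid β) [M.Finite] (G : Finset β), Core M 7 → G ∈ flatsQ M 5 →
    G.card ≤ 31 → TwoHyp M G 5 → (G.card ≤ 10 → 0 ≤ Jq M G 5 2) ∧ 0 ≤ Jq M G 5 3 ∧ 0 ≤ Jq M G 5 4

/-- `|G| ≤ 31` is automatic on rank-`5` flats of Core matroids. -/
theorem sevenFiveLayersCore_of_small (h : SevenFiveLayersCoreSmall) : SevenFiveLayersCore := by
  intro β _ M _ G hc hG hF
  have h32 := card_add_one_le_two_pow_of_core hc 5 G hG
  exact h M G hc hG (by norm_num at h32; omega) hF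

/-- **C-025 at `(7, 5)` on every finite matroid from the layers on `≤ 31`-point rank-`5` flats of rank-`7` Core
matroids.** -/
theorem rls_seven_five_of_layersCoreSmall {α : Type} [DecidableEq α] (h : SevenFiveLayersCoreSmall) (M : Matroid α)
    [M.Finite] : RLS M 7 5 :=
  rls_seven_five_of_layersCore (sevenFiveLayersCore_of_small h) M

/-- **Every line of a Core matroid has at most `3` points** (the size bound at rank `2`): the stars with `4`-point
lines that refute `OpenLayers q` for `q ≥ 10` are not flats of Core matroids. -/
theorem card_le_three_of_line_of_core {γ : Type} [DecidableEq γ] {M : Matroid γ} [M.Finite] {p : ℕ} (hc : Core M p)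
    {L : Finset γ} (hL : L ∈ flatsQ M 2) : L.card ≤ 3 := by
  have h := card_add_one_le_two_pow_of_core hc 2 L hL
  norm_num at h
  omega

/-- **Every rank-`q` flat of a Core matroid is in `𝔉_q`** (`q ≥ 1`): `G ∖ e` lies in two flats of rank `< q`
(`exists_cover_erase_of_core`), so `G ⊆ Z ∪ Z' ∪ {e, e}`. -/
theorem twoHyp_of_core {γ : Type} [DecidableEq γ] {M : Matroid γ} [M.Finite] {p q : ℕ} (hc : Core M p) (hq : 1 ≤ q)
    {G : Finset γ} (hG : G ∈ flatsQ M q) : TwoHyp M G q := by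
  have hne : G.Nonempty := by
    rw [Finset.nonempty_iff_ne_empty]
    rintro rfl
    have h := (mem_flatsQ.1 hG).2.2
    simp only [Finset.coe_empty, Matroid.eRk_empty] at h
    have : (q : ℕ∞) = 0 := h.symm
    exact absurd (by exact_mod_cast this : q = 0) (by omega)
  obtain ⟨e, he⟩ := hne
  obtain ⟨F₁, F₂, r₁, r₂, hr₁, hr₂, hF₁, hF₂, hF₁G, hF₂G, hcov⟩ := exists_cover_erase_of_core hc hG he
  refine ⟨F₁, F₂, e, e, hF₁G, hF₂G, ?_, ?_, ?_⟩
  · rw [(mem_flatsQ.1 hF₁).2.2]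
    exact_mod_cast hr₁
  · rw [(mem_flatsQ.1 hF₂).2.2]
    exact_mod_cast hr₂
  · intro x hx
    by_cases hxe : x = e
    · subst hxe
      simp
    · have hx' : x ∈ F₁ ∪ F₂ := hcov (Finset.mem_erase.2 ⟨hxe, hx⟩)
      rcases Finset.mem_union.1 hx' with h | h
      · exact Finset.mem_union.2 (Or.inl (Finset.mem_union.2 (Or.inl h)))
      · exact Finset.mem_union.2 (Or.inl (Finset.mem_union.2 (Or.inr h)))

/-- **The Core-typed layers on ALL rank-`q` flats** — the same three clauses without the `𝔉` hypothesis. -/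
def OpenLayersCoreAll (q : ℕ) : Prop :=
  ∀ {β : Type} [DecidableEq β] (M : Matroid β) [M.Finite] (G : Finset β), Core M (q + 2) → G ∈ flatsQ M q →
      (6 ≤ q → q + 2 ≤ G.card → (G.card - q) * (q + 3) + 1 < q * q → 0 ≤ Jq M G q 1) ∧
      ((G.card - q) * (G.card - q + 3) < 12 * (q - 1) → 0 ≤ Jq M G q 2) ∧
      (∀ t, 3 ≤ t → t + 1 ≤ q → 0 ≤ Jq M G q t)

/-- On the core the `𝔉` hypothesis is free: `OpenLayersCore q ↔ OpenLayersCoreAll q` (`q ≥ 1`). -/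
theorem openLayersCore_iff_all {q : ℕ} (hq : 1 ≤ q) : OpenLayersCore q ↔ OpenLayersCoreAll q := by
  constructor
  · intro h β _ M _ G hc hG
    exact h M G hc hG (twoHyp_of_core hc hq hG)
  · intro h β _ M _ G hc hG _
    exact h M G hc hG

end PercRepro.GenQ
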